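import Mathlib
import HarnessLib
import Literature.Analysis.FluidPDE.SelfSimilar
import Literature.Analysis.FluidPDE.NewtonKernelLogPotential

/-!
# Crux `QuarterLogPincer.TypeIQuantSubcubicExp` (stmt-NavierStokesRegularity-24077), EDGE line `truncation_edge`
  (ns-idea-7 g8, `Cruxes/TypeIQuantSubcubicExp/Lines/truncation_edge.lean` v1.1 `dca6249ee423`):
  obligation **T3 — the cube budget of the envelope**, PROVED (def body unfolded)

Prover file (nsreg-C26-p1 g7, DIRECTOR-NS #259 (2); `--supports stmt-NavierStokesRegularity-24077`, helper).
The line's support obligation T3 `stub_envelopeCubeBudget : StubEnvelopeCubeBudget` reads: for `A ≥ 0` and a field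
`v` in the envelope class `HasTypeIDecay A v` (`‖v(s,x)‖ ≤ A/(‖x‖ + √(−s))`, `s < 0`), the localised slices on `B(0,R)`,
`R ≥ 2`, over `s ∈ [−1, −ε]`, `ε ∈ (0,1]`, have `L³` norm `≤ b` with `b³ ≤ B·(1 + log R + log(1/ε))` (Barker–Prange 2021,
Cor. 1, upper bound, for DSS solutions; here for any enveloped field).  This file proves the statement with the body of
the line object `EnvelopeCubeBudget` UNFOLDED (`envelopeCubeBudget_of_hasTypeIDecay`), so that it does not wait for the
review of the line's Defs module; the by-name one-liner `stub_envelopeCubeBudget` follows in a separate file once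
`Theorems/QuarterLogPincerTruncationEdgeDefs.lean` is in the tree.

THE COMPUTATION (`lintegral_ball_enorm_cube_le_of_hasTypeIDecay`): with `a = √(−s) ∈ [√ε, 1]`, on the core ball `B(0,a)`
the envelope gives `‖v‖ ≤ A/a`, so the core costs `|B₁| A³`; on the annulus `a ≤ ‖x‖ < R` it gives `‖v‖ ≤ A/‖x‖`, so the
annulus costs `A³ · 3|B₁| log(R/a)` (the tree's `NewtonPotentialHolder.lintegral_annulus_norm_rpow_neg_three`); and
`log(R/a) ≤ log R + log(1/ε)`.  Hence `∫_{B(R)} ‖v(s)‖³ ≤ 3|B₁|A³(1 + log R + log(1/ε))`, `B = 3|B₁|A³`.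

HONEST FRAME: a calculus lemma about enveloped fields; the crux 24077, the edge's input T1, the envelope-class Liouville
wall (22144) and Navier–Stokes regularity are OPEN / not proved.  Texts of the line object by ns-idea-7 g8 (verbatim body).
-/

noncomputable section

-- the summit-side namespace repeats a component by design (D-0017)
set_option linter.dupNamespace false

namespace Summit.NavierStokesRegularity.NavierStokesRegularity.Cruxes.TypeIQuantSubcubicExp.TruncationEdge

open MeasureTheory Set Function Metric Filter Topology
open scoped ENNReal NNReal
open Literature.Analysis Literature.Analysis.FluidPDE

/-- `‖y‖ₑ ^ 3 = ofReal (‖y‖ ^ 3)` (real exponent `3`). [folklore] -/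
theorem enorm_rpow_three_eq_ofReal (y : EuclideanSpace ℝ (Fin 3)) :
    ‖y‖ₑ ^ (3 : ℝ) = ENNReal.ofReal (‖y‖ ^ 3) := by
  rw [show (3 : ℝ) = ((3 : ℕ) : ℝ) by norm_num, ENNReal.rpow_natCast, ← ofReal_norm,
    ENNReal.ofReal_pow (norm_nonneg _)]

/-- **The cube of an enveloped slice on a ball** (the computation of T3): for `A ≥ 0`, `HasTypeIDecay A v`, `R ≥ 2`,
`0 < ε ≤ 1` and `s ∈ [−1, −ε]`,
`∫_{B(0,R)} ‖v(s,x)‖³ dx ≤ 3 |B₁| A³ (1 + log R + log(1/ε))` (in `ℝ≥0∞`, real exponent `3`).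
Core ball `B(0, √(−s))`: `‖v‖ ≤ A/√(−s)`; annulus: `‖v‖ ≤ A/‖x‖` and `∫_{a≤|x|<R} |x|⁻³ = 3|B₁| log(R/a)`.
[cite: BarkerPrange2021, Cor. 1 (upper bound)] -/
theorem lintegral_ball_enorm_cube_le_of_hasTypeIDecay {A : ℝ}
    {v : ℝ → EuclideanSpace ℝ (Fin 3) → EuclideanSpace ℝ (Fin 3)}
    (hA : 0 ≤ A) (hdec : HasTypeIDecay A v) {R ε s : ℝ} (hR : 2 ≤ R) (hε : 0 < ε) (hε1 : ε ≤ 1)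
    (hs : s ∈ Icc (-1 : ℝ) (-ε)) :
    ∫⁻ x in ball (0 : EuclideanSpace ℝ (Fin 3)) R, ‖v s x‖ₑ ^ (3 : ℝ) ≤
      ENNReal.ofReal (3 * (volume : Measure (EuclideanSpace ℝ (Fin 3))).real (ball 0 1) * A ^ 3 *
        (1 + Real.log R + Real.log (1 / ε))) := by
  -- the core radius `a = √(-s)`
  have hs0 : s < 0 := by linarith [hs.2]
  have hns : ε ≤ -s := by linarith [hs.2]
  have hns1 : -s ≤ 1 := by linarith [hs.1]
  set a : ℝ := Real.sqrt (-s) with ha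
  have ha0 : 0 < a := Real.sqrt_pos.2 (by linarith)
  have haε : Real.sqrt ε ≤ a := Real.sqrt_le_sqrt hns
  have ha1 : a ≤ 1 := by rw [ha, Real.sqrt_le_one]; exact hns1
  have hR0 : 0 < R := by linarith
  have haR : a ≤ R := by linarith
  have hA3 : 0 ≤ A ^ 3 := pow_nonneg hA 3
  set VB : ℝ := (volume : Measure (EuclideanSpace ℝ (Fin 3))).real (ball 0 1) with hVB
  have hVB0 : 0 ≤ VB := measureReal_nonneg
  have hvolB : (volume : Measure (EuclideanSpace ℝ (Fin 3))) (ball 0 1) = ENNReal.ofReal VB :=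
    (ofReal_measureReal (measure_ball_lt_top.ne)).symm
  -- pointwise envelope on the slice `s`
  have henv : ∀ x : EuclideanSpace ℝ (Fin 3), ‖v s x‖ ≤ A / (‖x‖ + a) := fun x => hdec s hs0 x
  -- split the ball into the core and the annulus
  have hsplit : ball (0 : EuclideanSpace ℝ (Fin 3)) R ⊆
      ball 0 a ∪ (ball 0 R \ ball 0 a) := by
    intro x hx
    by_cases h : x ∈ ball (0 : EuclideanSpace ℝ (Fin 3)) a
    · exact Or.inl h
    · exact Or.inr ⟨hx, h⟩
  -- the core
  have hcore : ∫⁻ x in ball (0 : EuclideanSpace ℝ (Fin 3)) a, ‖v s x‖ₑ ^ (3 : ℝ) ≤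
      ENNReal.ofReal (A ^ 3) * ENNReal.ofReal VB := by
    calc ∫⁻ x in ball (0 : EuclideanSpace ℝ (Fin 3)) a, ‖v s x‖ₑ ^ (3 : ℝ)
        ≤ ∫⁻ x in ball (0 : EuclideanSpace ℝ (Fin 3)) a, ENNReal.ofReal ((A / a) ^ 3) := by
          refine setLIntegral_mono' measurableSet_ball fun x _ => ?_
          rw [enorm_rpow_three_eq_ofReal]
          refine ENNReal.ofReal_le_ofReal (pow_le_pow_left₀ (norm_nonneg _) ?_ 3)
          exact (henv x).trans (div_le_div_of_nonneg_left hA ha0 (by linarith [norm_nonneg x]))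
      _ = ENNReal.ofReal ((A / a) ^ 3) * volume (ball (0 : EuclideanSpace ℝ (Fin 3)) a) :=
          setLIntegral_const _ _
      _ = ENNReal.ofReal (A ^ 3) * ENNReal.ofReal VB := by
          rw [Measure.addHaar_ball_of_pos _ _ ha0, finrank_euclideanSpace, Fintype.card_fin, hvolB,
            ← mul_assoc, ← ENNReal.ofReal_mul (pow_nonneg (div_nonneg hA ha0.le) 3)]
          congr 2
          rw [div_pow, div_mul_cancel₀ _ (pow_ne_zero 3 ha0.ne')]
  -- the annulus
  have hann : ∫⁻ x in ball (0 : EuclideanSpace ℝ (Fin 3)) R \ ball 0 a, ‖v s x‖ₑ ^ (3 : ℝ) ≤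
      ENNReal.ofReal (A ^ 3) * ENNReal.ofReal (3 * VB * Real.log (R / a)) := by
    calc ∫⁻ x in ball (0 : EuclideanSpace ℝ (Fin 3)) R \ ball 0 a, ‖v s x‖ₑ ^ (3 : ℝ)
        ≤ ∫⁻ x in ball (0 : EuclideanSpace ℝ (Fin 3)) R \ ball 0 a,
            ENNReal.ofReal (A ^ 3 * ‖x‖ ^ (-3 : ℝ)) := by
          refine setLIntegral_mono' (measurableSet_ball.diff measurableSet_ball) fun x hx => ?_
          rw [enorm_rpow_three_eq_ofReal]
          have hxa : a ≤ ‖x‖ := by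
            have h2 := hx.2
            rw [mem_ball_zero_iff, not_lt] at h2
            exact h2
          have hxpos : 0 < ‖x‖ := lt_of_lt_of_le ha0 hxa
          have h1 : ‖v s x‖ ≤ A / ‖x‖ :=
            (henv x).trans (div_le_div_of_nonneg_left hA hxpos (by linarith))
          refine ENNReal.ofReal_le_ofReal ?_
          have e3 : ‖x‖ ^ (-3 : ℝ) = (‖x‖ ^ 3)⁻¹ := by
            rw [Real.rpow_neg (norm_nonneg _)]
            norm_num
          calc ‖v s x‖ ^ 3 ≤ (A / ‖x‖) ^ 3 := pow_le_pow_left₀ (norm_nonneg _) h1 3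
            _ = A ^ 3 * ‖x‖ ^ (-3 : ℝ) := by rw [e3, div_pow, div_eq_mul_inv]
      _ = ENNReal.ofReal (A ^ 3) *
            ∫⁻ x in ball (0 : EuclideanSpace ℝ (Fin 3)) R \ ball 0 a, ENNReal.ofReal (‖x‖ ^ (-3 : ℝ)) := by
          rw [← lintegral_const_mul' _ _ ENNReal.ofReal_ne_top]
          exact lintegral_congr fun x => ENNReal.ofReal_mul hA3
      _ = ENNReal.ofReal (A ^ 3) * ENNReal.ofReal (3 * VB * Real.log (R / a)) := by
          rw [NewtonPotentialHolder.lintegral_annulus_norm_rpow_neg_three ha0 haR]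
  -- the logarithm: `log(R/a) ≤ log R + log(1/ε)`
  have hlogR : 0 ≤ Real.log R := Real.log_nonneg (by linarith)
  have hlogε : 0 ≤ Real.log (1 / ε) := Real.log_nonneg (by rw [le_div_iff₀ hε]; linarith)
  have hlog : Real.log (R / a) ≤ Real.log R + Real.log (1 / ε) := by
    have hsqε : 0 < Real.sqrt ε := Real.sqrt_pos.2 hε
    have hεsq : ε ≤ Real.sqrt ε := by
      have h1 : Real.sqrt ε ≤ 1 := by rw [Real.sqrt_le_one]; exact hε1
      calc ε = Real.sqrt ε * Real.sqrt ε := (Real.mul_self_sqrt hε.le).symm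
        _ ≤ Real.sqrt ε * 1 := mul_le_mul_of_nonneg_left h1 hsqε.le
        _ = Real.sqrt ε := mul_one _
    have h1 : R / a ≤ R * (1 / ε) := by
      calc R / a ≤ R / Real.sqrt ε := div_le_div_of_nonneg_left hR0.le hsqε haε
        _ ≤ R / ε := div_le_div_of_nonneg_left hR0.le hε hεsq
        _ = R * (1 / ε) := by rw [mul_one_div]
    calc Real.log (R / a) ≤ Real.log (R * (1 / ε)) :=
          Real.log_le_log (div_pos hR0 ha0) h1
      _ = Real.log R + Real.log (1 / ε) := Real.log_mul hR0.ne' (by positivity)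
  -- assemble
  calc ∫⁻ x in ball (0 : EuclideanSpace ℝ (Fin 3)) R, ‖v s x‖ₑ ^ (3 : ℝ)
      ≤ ∫⁻ x in ball (0 : EuclideanSpace ℝ (Fin 3)) a ∪ (ball 0 R \ ball 0 a), ‖v s x‖ₑ ^ (3 : ℝ) :=
        lintegral_mono_set hsplit
    _ ≤ (∫⁻ x in ball (0 : EuclideanSpace ℝ (Fin 3)) a, ‖v s x‖ₑ ^ (3 : ℝ)) +
          ∫⁻ x in ball (0 : EuclideanSpace ℝ (Fin 3)) R \ ball 0 a, ‖v s x‖ₑ ^ (3 : ℝ) :=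
        lintegral_union_le _ _ _
    _ ≤ ENNReal.ofReal (A ^ 3) * ENNReal.ofReal VB +
          ENNReal.ofReal (A ^ 3) * ENNReal.ofReal (3 * VB * Real.log (R / a)) := add_le_add hcore hann
    _ = ENNReal.ofReal (A ^ 3 * (VB + 3 * VB * Real.log (R / a))) := by
        rw [← mul_add, ← ENNReal.ofReal_add hVB0 (by
          have : 0 ≤ Real.log (R / a) := Real.log_nonneg (by rw [le_div_iff₀ ha0]; linarith)
          positivity), ← ENNReal.ofReal_mul hA3]
    _ ≤ ENNReal.ofReal (3 * VB * A ^ 3 * (1 + Real.log R + Real.log (1 / ε))) := by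
        refine ENNReal.ofReal_le_ofReal ?_
        have h1 : VB ≤ 3 * VB := by linarith
        have h2 : 3 * VB * Real.log (R / a) ≤ 3 * VB * (Real.log R + Real.log (1 / ε)) :=
          mul_le_mul_of_nonneg_left hlog (by positivity)
        nlinarith [mul_nonneg hA3 hVB0, mul_nonneg hA3 (mul_nonneg (by positivity : (0:ℝ) ≤ 3 * VB) hlogR),
          mul_nonneg hA3 (mul_nonneg (by positivity : (0:ℝ) ≤ 3 * VB) hlogε)]

/-- **T3 of line `truncation_edge` — the CUBE BUDGET OF THE ENVELOPE** (the body of the line object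
`EnvelopeCubeBudget v`, unfolded): for `A ≥ 0` and `HasTypeIDecay A v` there is `B ≥ 0` (namely `B = 3|B₁|A³`) such that
for every `R ≥ 2` and `ε ∈ (0,1]` some `b ≥ 0` with `b³ ≤ B(1 + log R + log(1/ε))` bounds the `L³(ℝ³)` norm of the
localised slices `𝟙_{B(0,R)} v(s)`, `s ∈ [−1, −ε]`.  [cite: BarkerPrange2021, Cor. 1 (upper bound)] -/
theorem envelopeCubeBudget_of_hasTypeIDecay (A : ℝ)
    (v : ℝ → EuclideanSpace ℝ (Fin 3) → EuclideanSpace ℝ (Fin 3))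
    (hA : 0 ≤ A) (hdec : HasTypeIDecay A v) :
    ∃ B : ℝ, 0 ≤ B ∧ ∀ R : ℝ, 2 ≤ R → ∀ ε ∈ Set.Ioc (0 : ℝ) 1, ∃ b : ℝ, 0 ≤ b ∧
      b ^ 3 ≤ B * (1 + Real.log R + Real.log (1 / ε)) ∧
      ∀ s ∈ Set.Icc (-1 : ℝ) (-ε),
        eLpNorm ((Metric.ball (0 : EuclideanSpace ℝ (Fin 3)) R).indicator (v s)) 3 volume ≤
          ENNReal.ofReal b := by
  set VB : ℝ := (volume : Measure (EuclideanSpace ℝ (Fin 3))).real (ball 0 1) with hVB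
  have hVB0 : 0 ≤ VB := measureReal_nonneg
  have hA3 : 0 ≤ A ^ 3 := pow_nonneg hA 3
  refine ⟨3 * VB * A ^ 3, by positivity, fun R hR ε hε => ?_⟩
  have hlogR : 0 ≤ Real.log R := Real.log_nonneg (by linarith)
  have hlogε : 0 ≤ Real.log (1 / ε) := Real.log_nonneg (by rw [le_div_iff₀ hε.1]; linarith [hε.2])
  set Q : ℝ := 3 * VB * A ^ 3 * (1 + Real.log R + Real.log (1 / ε)) with hQ
  have hQ0 : 0 ≤ Q := by positivity
  refine ⟨Q ^ (1 / 3 : ℝ), Real.rpow_nonneg hQ0 _, ?_, fun s hs => ?_⟩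
  · -- `(Q^{1/3})³ = Q`
    rw [← Real.rpow_natCast, ← Real.rpow_mul hQ0]
    norm_num
  · -- the `L³` norm of the localised slice
    have h3 : (3 : ℝ≥0∞).toReal = 3 := by norm_num
    rw [eLpNorm_eq_lintegral_rpow_enorm_toReal (by norm_num) (by norm_num), h3]
    have hind : (fun x => ‖(ball (0 : EuclideanSpace ℝ (Fin 3)) R).indicator (v s) x‖ₑ ^ (3 : ℝ)) =
        (ball (0 : EuclideanSpace ℝ (Fin 3)) R).indicator (fun x => ‖v s x‖ₑ ^ (3 : ℝ)) := by
      funext x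
      rw [enorm_indicator_eq_indicator_enorm]
      by_cases hx : x ∈ ball (0 : EuclideanSpace ℝ (Fin 3)) R
      · rw [indicator_of_mem hx, indicator_of_mem hx]
      · rw [indicator_of_notMem hx, indicator_of_notMem hx, ENNReal.zero_rpow_of_pos (by norm_num)]
    rw [hind, lintegral_indicator measurableSet_ball]
    calc (∫⁻ x in ball (0 : EuclideanSpace ℝ (Fin 3)) R, ‖v s x‖ₑ ^ (3 : ℝ)) ^ (1 / (3 : ℝ))
        ≤ (ENNReal.ofReal Q) ^ (1 / (3 : ℝ)) :=
          ENNReal.rpow_le_rpow (lintegral_ball_enorm_cube_le_of_hasTypeIDecay hA hdec hR hε.1 hε.2 hs)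
            (by norm_num)
      _ = ENNReal.ofReal (Q ^ (1 / 3 : ℝ)) := ENNReal.ofReal_rpow_of_nonneg hQ0 (by norm_num)

end Summit.NavierStokesRegularity.NavierStokesRegularity.Cruxes.TypeIQuantSubcubicExp.TruncationEdge

end
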